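import Summits.QuantumFields.YangMills.Theorems.UnitScaleTiltProp8EulerLagrangeCarrier
import Summits.QuantumFields.YangMills.Theorems.UnitScaleTiltProp7PV3CUniqueness
import Mathlib.Analysis.Calculus.LocalExtr.Basic
import HarnessLib

/-!
# Route `UnitScaleTilt`, crux K1 child «MinimiserStabilityRegPr» (stmt-QuantumFields-19200), skeleton v9 stub `stub_PV3Cuniq` (OWNER RULING g24-№3′, w2's seat) —
# «R2-CRITICAL ⇒ EULER–LAGRANGE» AT THE CARRIER, AND `stub_PV3Cuniq` ⇐ THE UNIQUENESS HALF OF [Balaban1985Variational] PROP. 6 IN ITS EULER–LAGRANGE READING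

Cell `ym3-torus`, width seat `ym-ust-19200-w2` (gen 0).  YM₃ on T³ is a ladder rung (R3), not the Clay problem; nothing here is a claim about the crux, d = 4 or the mass gap.

WHY.  `stub_PV3Cuniq` (= the hypothesis `hCuniq` of `Prop7PV3CUniqueness.prop7From14At_v8_of_A_Cuniq_att`) says: two `𝔤`-valued `X, X′` in the (19)-ball `ε₄` over a
(14)-background which satisfy (20), (21) and make `e^{iX}U₀` «L-critical» (`CritLPrint`: an axial representative `(e^{iX}U₀)^u`, `u` restricted (1.29), is critical in the
carrier's reading R2 = minimiser of (5) over SOME regular fibre (6)(e′)) coincide.  Print's Prop. 6 is about solutions of the VARIATIONAL EQUATION (111) (p. 294); the owner's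
residue list for this seat names the bridge «L-critical in the ball ⇒ (111)».  At the carrier that bridge is Fermat's lemma: (6)(e′) = `𝔘_k(e′) ∩ 𝔅_k(V)` is relatively OPEN
in the fibre (both clauses of (2) are strict inequalities of continuous functions of the configuration — `Prop8Criticality.continuous_coe_plaqHol` ∕ `continuous_covDivT`),
so along every fibre-valued curve through an R2-critical `W`, differentiable at `0` in the bond variables, `t ↦ A(γ(t))` has a local minimum at `0`, hence derivative `0`
(§§1–2).  §3 is the bookkeeping `stub_PV3Cuniq ⇐ EL-uniqueness`, where EL-uniqueness is `stub_PV3Cuniq`'s text with «R2-critical» replaced by the def-free EULER–LAGRANGE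
schema «`deriv (A ∘ γ) 0 = 0` for every curve `γ` in `𝔅_k(V)` through `(e^{iX}U₀)^u`, bondwise differentiable at `0`» — the classical constrained first-order condition,
which print's (111) expresses in the chart (47)–(48); so EL-uniqueness is exactly the uniqueness half of Prop. 6 read at the T³ objects, and it is what the contraction
(116)–(121) must deliver.

WHAT IS PROVED (sorry-free, no definition).
§1 `isOpen_regPr` — `𝔘_k(e)` is open in `SU(2)^{bonds}`.
§2 **`isLocalMin_comp_of_isCritR2`**, **`deriv_comp_eq_zero_of_isCritR2`** — for `W` R2-critical over `V` and `γ : ℝ → SU(2)^{bonds}` with `γ 0 = W`, `γ t ∈ 𝔅_k(V)`, `γ`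
   continuous at `0`: `t ↦ A(γ t)` has a local minimum at `0` and `deriv (A ∘ γ) 0 = 0` (Fermat, `IsLocalMin.deriv_eq_zero`); `continuousAt_of_differentiableAt_bonds`.
§3 **`stubPV3Cuniq_of_ELuniq`** — the registered v9 text of `stub_PV3Cuniq` at `(L, B₃)` from the EL-uniqueness schema (same binders; hypothesis displayed in full).

HONEST SCOPE.  EL-uniqueness (Prop. 6's uniqueness: [Balaban1985Variational] (116)–(121) with [Balaban1985GreensFunctions] Thm 3.13's `B₀`, in the chart of Props 3–4) is a
HYPOTHESIS; this file proves only the carrier-side first-order condition and the reduction.  Count-neutral helper toward stmt-QuantumFields-19200 (`--supports`), not a proof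
of the stub.

References: T. Bałaban, CMP 102 (1985) 277–309 [Balaban1985Variational] ((2), (5)–(6) p.278, (19)–(21) p.281, (111) p.294, Prop. 6 p.295, p.300); CMP 99 (1985) 75–102
[Balaban1985RegularSpaces] ((1.1)–(1.2) p.76, (1.29) p.81).
-/

noncomputable section

open scoped Matrix.Norms.L2Operator Topology
open Filter

namespace Summit.QuantumFields.YangMills.Theorems.Prop7CritEL

open Literature.MathematicalPhysics.QuantumFieldTheory.Balaban1983to89
open Literature.MathematicalPhysics.QuantumFieldTheory.Balaban1983to89.T3ContinuumYM3Torus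
open Literature.MathematicalPhysics.QuantumFieldTheory.Balaban1983to89.T3UnitLawDensityEML (ℰp)
open Literature.MathematicalPhysics.QuantumFieldTheory.Balaban1983to89.T3DescentFibreTower
open Literature.MathematicalPhysics.QuantumFieldTheory.Balaban1983to89.T3ConstrainedMinimiser
open Literature.MathematicalPhysics.QuantumFieldTheory.Balaban1983to89.T3TiltDescent
open Literature.MathematicalPhysics.QuantumFieldTheory.Balaban1983to89.T3Thm1Carrier
open Literature.MathematicalPhysics.QuantumFieldTheory.Balaban1983to89.T3PrintedRegularMinimiser
open Literature.MathematicalPhysics.QuantumFieldTheory.Balaban1983to89.T3RegularMinimiser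
open Literature.MathematicalPhysics.QuantumFieldTheory.Balaban1983to89.T3Thm1CarrierNative (IsCritR2)
open Literature.MathematicalPhysics.QuantumFieldTheory.Balaban1983to89.T3SectALandauChart
open B10Eq27TorusAxialLog (toUField unitsField)
open B10Eq68TorusRegularity (covDivT)
open Summit.QuantumFields.YangMills.Theorems.Prop8Criticality (continuous_coe_plaqHol continuous_covDivT continuous_coe_apply)
open Summit.QuantumFields.YangMills.Theorems.Prop7TPrint
open Summit.QuantumFields.YangMills.Theorems.Prop7SPrint

/-! ## §1 `𝔘_k(e)` is open -/

/-- **`𝔘_k(e)` IS OPEN IN `SU(2)^{bonds}`**: both clauses of (2) are finitely many strict inequalities of continuous functions of the configuration (the internal step of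
`Prop8Criticality.exists_ball_subset_regPr`, displayed). [cite: Balaban1985Variational, (2) p.278] -/
theorem isOpen_regPr (F : T3Family) (n K : ℕ) (e : ℝ) :
    IsOpen {U : GaugeField (F.P K) 0 (Matrix.specialUnitaryGroup (Fin 2) ℂ) | RegPr F n K e U} := by
  have hOeq : {U : GaugeField (F.P K) 0 (Matrix.specialUnitaryGroup (Fin 2) ℂ) | RegPr F n K e U} =
      (⋂ p : Plaq (F.P K) 0, {U | ‖((GaugeField.plaqHol U p : Matrix.specialUnitaryGroup (Fin 2) ℂ) : Matrix (Fin 2) (Fin 2) ℂ) - 1‖ < regThreshold F n K e}) ∩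
      ⋂ b : PBond (F.P K) 0, {U | ‖covDivT 1 (unitsField (toUField U)) b.dir b.src‖ < e * ((F.L : ℝ)⁻¹) ^ (3 * (K - n))} := by
    ext U
    simp only [Set.mem_setOf_eq, Set.mem_inter_iff, Set.mem_iInter, RegPr, PlaqSmall, DivSmall, SU2Mean.dist1_eq_norm]
  rw [hOeq]
  exact (isOpen_iInter_of_finite fun p => isOpen_lt ((continuous_coe_plaqHol p).sub continuous_const).norm continuous_const).inter
    (isOpen_iInter_of_finite fun b => isOpen_lt (continuous_covDivT b.dir b.src).norm continuous_const)

/-! ## §2 Fermat: R2-critical ⇒ the first-order condition along fibre-valued curves -/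

/-- A curve in `SU(2)^{bonds}` which is differentiable at `0` in every bond variable (read in `M₂(ℂ)`) is continuous at `0`. [folklore] -/
theorem continuousAt_of_differentiableAt_bonds {F : T3Family} {K : ℕ} (γ : ℝ → GaugeField (F.P K) 0 (Matrix.specialUnitaryGroup (Fin 2) ℂ))
    (hγ : ∀ b, DifferentiableAt ℝ (fun t => ((γ t b : Matrix.specialUnitaryGroup (Fin 2) ℂ) : Matrix (Fin 2) (Fin 2) ℂ)) 0) : ContinuousAt γ 0 := by
  refine continuousAt_pi.2 fun b => ?_
  have h := (hγ b).continuousAt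
  exact (Topology.IsInducing.subtypeVal.continuousAt_iff).2 h

/-- **R2-CRITICAL ⇒ LOCAL MINIMUM ALONG FIBRE-VALUED CURVES**: if `W` minimises the Wilson action over print's regular fibre (6)(e′) for some `e′` and `γ` is a curve in the fibre
`𝔅_k(V)` with `γ 0 = W`, continuous at `0`, then `t ↦ A(γ t)` has a local minimum at `0` — (6)(e′) is relatively open in the fibre (§1).
[cite: Balaban1985Variational, (5)-(6) p.278, p.300] -/
theorem isLocalMin_comp_of_isCritR2 {F : T3Family} {n K : ℕ} {h : n ≤ K} {V : GaugeField (F.P n) 0 (Matrix.specialUnitaryGroup (Fin 2) ℂ)}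
    {W : GaugeField (F.P K) 0 (Matrix.specialUnitaryGroup (Fin 2) ℂ)} (hW : IsCritR2 F n K h V W)
    (γ : ℝ → GaugeField (F.P K) 0 (Matrix.specialUnitaryGroup (Fin 2) ℂ)) (hγ0 : γ 0 = W) (hγfib : ∀ t, γ t ∈ fibre F ℰp n K h V) (hγc : ContinuousAt γ 0) :
    IsLocalMin (fun t => wilsonAction4 (γ t)) 0 := by
  obtain ⟨e, _he, hWmem, hmin⟩ := hW
  have hWreg : RegPr F n K e W := ((mem_regFibrePr_iff F).mp hWmem).2
  have hO : {U : GaugeField (F.P K) 0 (Matrix.specialUnitaryGroup (Fin 2) ℂ) | RegPr F n K e U} ∈ 𝓝 (γ 0) := by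
    rw [hγ0]; exact (isOpen_regPr F n K e).mem_nhds hWreg
  have hev : ∀ᶠ t in 𝓝 (0 : ℝ), RegPr F n K e (γ t) := hγc.preimage_mem_nhds hO
  show ∀ᶠ t in 𝓝 (0 : ℝ), wilsonAction4 (γ 0) ≤ wilsonAction4 (γ t)
  filter_upwards [hev] with t ht
  rw [hγ0]
  exact hmin ((mem_regFibrePr_iff F).mpr ⟨hγfib t, ht⟩)

/-- **R2-CRITICAL ⇒ EULER–LAGRANGE (Fermat)**: under the hypotheses of `isLocalMin_comp_of_isCritR2`, `deriv (A ∘ γ) 0 = 0` — the carrier-side content of «a minimiser over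
the open space (6) is a critical configuration of (5) on 𝔅_k(V)», print's (111) along the curve. [cite: Balaban1985Variational, (111) p.294, p.300] -/
theorem deriv_comp_eq_zero_of_isCritR2 {F : T3Family} {n K : ℕ} {h : n ≤ K} {V : GaugeField (F.P n) 0 (Matrix.specialUnitaryGroup (Fin 2) ℂ)}
    {W : GaugeField (F.P K) 0 (Matrix.specialUnitaryGroup (Fin 2) ℂ)} (hW : IsCritR2 F n K h V W)
    (γ : ℝ → GaugeField (F.P K) 0 (Matrix.specialUnitaryGroup (Fin 2) ℂ)) (hγ0 : γ 0 = W) (hγfib : ∀ t, γ t ∈ fibre F ℰp n K h V) (hγc : ContinuousAt γ 0) :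
    deriv (fun t => wilsonAction4 (γ t)) 0 = 0 :=
  (isLocalMin_comp_of_isCritR2 hW γ hγ0 hγfib hγc).deriv_eq_zero

/-! ## §3 `stub_PV3Cuniq` from the uniqueness half of Prop. 6 in the Euler–Lagrange reading -/

/-- **`stub_PV3Cuniq` ⇐ EL-UNIQUENESS** at `(L, B₃)`: the v9 stub's text (two small Landau-gauge `X, X′` with `e^{iX}U₀`, `e^{iX′}U₀` L-critical in reading R2 coincide) from the
same text with «R2-critical» replaced by the Euler–Lagrange schema along bondwise-differentiable fibre-valued curves (§2 supplies R2 ⇒ EL).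
[cite: Balaban1985Variational, Prop. 6 p.295, (111) p.294] -/
theorem stubPV3Cuniq_of_ELuniq (L : ℕ) (B₃ : ℝ)
    (hEL : ∃ B₀ a₄ : ℝ, 0 < B₀ ∧ 0 < a₄ ∧ ∀ (i : Idx L) (ε₁ ε₄ : ℝ), 0 < ε₁ → ε₄ ≤ a₄ → 2 * B₀ * (L : ℝ) ^ 3 * B₃ * ε₁ ≤ ε₄ →
      ∀ (V : GaugeField (i.1.1.P i.1.2.1) 0 (Matrix.specialUnitaryGroup (Fin 2) ℂ)) (U₀ : GaugeField (i.1.1.P i.1.2.2) 0 (Matrix.specialUnitaryGroup (Fin 2) ℂ)),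
        RegPr i.1.1 i.1.2.1 i.1.2.2 ((L : ℝ) ^ 3 * B₃ * ε₁) U₀ → CloseAvg i.1.1 i.1.2.1 i.1.2.2 i.2.2.le ((L : ℝ) ^ 3 * ε₁) V U₀ →
        ∀ X X' : PBond (i.1.1.P i.1.2.2) 0 → Matrix (Fin 2) (Fin 2) ℂ,
          nMax19 i.1.1 i.1.2.1 i.1.2.2 U₀ X < ε₄ →
          ((∀ b : PBond (i.1.1.P i.1.2.2) 0, (X b).IsHermitian ∧ Matrix.trace (X b) = 0) ∧ AvgCondPrint i.1.1 i.1.2.1 i.1.2.2 i.2.2.le V U₀ X ∧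
            IsLandauPrint i.1.1 i.1.2.1 i.1.2.2 U₀ X ∧ (∃ u : GaugeTransf (i.1.1.P i.1.2.2) 0 (Matrix.specialUnitaryGroup (Fin 2) ℂ), RestrictedPrint i.1.1 i.1.2.1 i.1.2.2 U₀ u ∧
              IsAxialPrint i.1.1 i.1.2.1 i.1.2.2 U₀ (GaugeField.gaugeAct u (emb15 U₀ (expHermField X))) ∧
              ∀ γ : ℝ → GaugeField (i.1.1.P i.1.2.2) 0 (Matrix.specialUnitaryGroup (Fin 2) ℂ), γ 0 = GaugeField.gaugeAct u (emb15 U₀ (expHermField X)) →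
                (∀ t, γ t ∈ fibre i.1.1 ℰp i.1.2.1 i.1.2.2 i.2.2.le V) →
                (∀ b, DifferentiableAt ℝ (fun t => ((γ t b : Matrix.specialUnitaryGroup (Fin 2) ℂ) : Matrix (Fin 2) (Fin 2) ℂ)) 0) →
                  deriv (fun t => wilsonAction4 (γ t)) 0 = 0)) →
          nMax19 i.1.1 i.1.2.1 i.1.2.2 U₀ X' < ε₄ →
          ((∀ b : PBond (i.1.1.P i.1.2.2) 0, (X' b).IsHermitian ∧ Matrix.trace (X' b) = 0) ∧ AvgCondPrint i.1.1 i.1.2.1 i.1.2.2 i.2.2.le V U₀ X' ∧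
            IsLandauPrint i.1.1 i.1.2.1 i.1.2.2 U₀ X' ∧ (∃ u : GaugeTransf (i.1.1.P i.1.2.2) 0 (Matrix.specialUnitaryGroup (Fin 2) ℂ), RestrictedPrint i.1.1 i.1.2.1 i.1.2.2 U₀ u ∧
              IsAxialPrint i.1.1 i.1.2.1 i.1.2.2 U₀ (GaugeField.gaugeAct u (emb15 U₀ (expHermField X'))) ∧
              ∀ γ : ℝ → GaugeField (i.1.1.P i.1.2.2) 0 (Matrix.specialUnitaryGroup (Fin 2) ℂ), γ 0 = GaugeField.gaugeAct u (emb15 U₀ (expHermField X')) →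
                (∀ t, γ t ∈ fibre i.1.1 ℰp i.1.2.1 i.1.2.2 i.2.2.le V) →
                (∀ b, DifferentiableAt ℝ (fun t => ((γ t b : Matrix.specialUnitaryGroup (Fin 2) ℂ) : Matrix (Fin 2) (Fin 2) ℂ)) 0) →
                  deriv (fun t => wilsonAction4 (γ t)) 0 = 0)) → X = X') :
    ∃ B₀ a₄ : ℝ, 0 < B₀ ∧ 0 < a₄ ∧ ∀ (i : Idx L) (ε₁ ε₄ : ℝ), 0 < ε₁ → ε₄ ≤ a₄ → 2 * B₀ * (L : ℝ) ^ 3 * B₃ * ε₁ ≤ ε₄ →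
      ∀ (V : GaugeField (i.1.1.P i.1.2.1) 0 (Matrix.specialUnitaryGroup (Fin 2) ℂ)) (U₀ : GaugeField (i.1.1.P i.1.2.2) 0 (Matrix.specialUnitaryGroup (Fin 2) ℂ)),
        RegPr i.1.1 i.1.2.1 i.1.2.2 ((L : ℝ) ^ 3 * B₃ * ε₁) U₀ → CloseAvg i.1.1 i.1.2.1 i.1.2.2 i.2.2.le ((L : ℝ) ^ 3 * ε₁) V U₀ →
        ∀ X X' : PBond (i.1.1.P i.1.2.2) 0 → Matrix (Fin 2) (Fin 2) ℂ,
          nMax19 i.1.1 i.1.2.1 i.1.2.2 U₀ X < ε₄ →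
          ((∀ b : PBond (i.1.1.P i.1.2.2) 0, (X b).IsHermitian ∧ Matrix.trace (X b) = 0) ∧ AvgCondPrint i.1.1 i.1.2.1 i.1.2.2 i.2.2.le V U₀ X ∧
            IsLandauPrint i.1.1 i.1.2.1 i.1.2.2 U₀ X ∧ CritLPrint i.1.1 i.1.2.1 i.1.2.2 i.2.2.le V U₀ (expHermField X)) →
          nMax19 i.1.1 i.1.2.1 i.1.2.2 U₀ X' < ε₄ →
          ((∀ b : PBond (i.1.1.P i.1.2.2) 0, (X' b).IsHermitian ∧ Matrix.trace (X' b) = 0) ∧ AvgCondPrint i.1.1 i.1.2.1 i.1.2.2 i.2.2.le V U₀ X' ∧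
            IsLandauPrint i.1.1 i.1.2.1 i.1.2.2 U₀ X' ∧ CritLPrint i.1.1 i.1.2.1 i.1.2.2 i.2.2.le V U₀ (expHermField X')) → X = X' := by
  obtain ⟨B₀, a₄, hB₀, ha₄, HEL⟩ := hEL
  refine ⟨B₀, a₄, hB₀, ha₄, ?_⟩
  intro i ε₁ ε₄ hε₁ hε₄ h2B V U₀ hR hcl X X' hX hsX hX' hsX'
  obtain ⟨⟨F, n, K⟩, hF, hnK⟩ := i
  -- R2 ⇒ EL for both solutions
  have hEL_of : ∀ Y : PBond (F.P K) 0 → Matrix (Fin 2) (Fin 2) ℂ, CritLPrint F n K hnK.le V U₀ (expHermField Y) →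
      ∃ u : GaugeTransf (F.P K) 0 (Matrix.specialUnitaryGroup (Fin 2) ℂ), RestrictedPrint F n K U₀ u ∧
        IsAxialPrint F n K U₀ (GaugeField.gaugeAct u (emb15 U₀ (expHermField Y))) ∧
        ∀ γ : ℝ → GaugeField (F.P K) 0 (Matrix.specialUnitaryGroup (Fin 2) ℂ), γ 0 = GaugeField.gaugeAct u (emb15 U₀ (expHermField Y)) →
          (∀ t, γ t ∈ fibre F ℰp n K hnK.le V) →
          (∀ b, DifferentiableAt ℝ (fun t => ((γ t b : Matrix.specialUnitaryGroup (Fin 2) ℂ) : Matrix (Fin 2) (Fin 2) ℂ)) 0) →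
            deriv (fun t => wilsonAction4 (γ t)) 0 = 0 := by
    intro Y hY
    obtain ⟨u, hu, hax, hR2⟩ := hY
    exact ⟨u, hu, hax, fun γ hγ0 hγfib hγd => deriv_comp_eq_zero_of_isCritR2 hR2 γ hγ0 hγfib (continuousAt_of_differentiableAt_bonds γ hγd)⟩
  obtain ⟨hXh, h20, h21, hcrit⟩ := hsX
  obtain ⟨hXh', h20', h21', hcrit'⟩ := hsX'
  exact HEL ⟨(F, n, K), hF, hnK⟩ ε₁ ε₄ hε₁ hε₄ h2B V U₀ hR hcl X X' hX ⟨hXh, h20, h21, hEL_of X hcrit⟩ hX' ⟨hXh', h20', h21', hEL_of X' hcrit'⟩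

end Summit.QuantumFields.YangMills.Theorems.Prop7CritEL

end
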